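import Mathlib
import Literature.Computability.AlgebraicComplexity.BurgisserBooleanPartsA3Steps
import HarnessLib

/-!
# Route GaugeDescent — `DescentGlue` (stmt-ValiantsHypothesis-6637), part A: the slot system of a
# skeleton identity and its transfer along relation-preserving maps

For an integer polynomial `Q ∈ ℤ[x_σ, y_τ]` (a constant-free skeleton with slot indeterminates
`y_τ`, as produced by the crux `GeomRigidity`) and a target `T ∈ ℤ[x_σ]` (here: `per_n`), the
identity `Q(x, y) = T(x)` in `A[x_σ]` at a point `y ∈ A^τ` of a commutative ring `A` is equivalent
to the vanishing at `y` of finitely many integer polynomials in the slots — the SLOT SYSTEM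
`slotSystem Q T : Fin s → ℤ[y_τ]` (coefficient of `x^e` in `Q(x, y)` minus the coefficient of `x^e`
in `T`). We prove

* `coeff_aeval_sumElim` — the `x^e`-coefficient of `Q(x, y)` is `slotPoly Q e` evaluated at `y`;
* `aeval_sumElim_eq_map_iff` — `Q(x, y) = T` iff `y` solves the slot system;
* `totalDegree_slotSystem_le`, `weight_slotSystem_le` — the equations have degree `≤ deg Q` and
  weight `≤ wt Q + wt T` (the format of Bürgisser's Thm. 4.5, `algebraicSolution_height_bound`);
* `aeval_sumElim_eq_map_of_relations` — if every integer polynomial relation of `y` holds for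
  `y'`, then `Q(x, y) = T` implies `Q(x, y') = T` (used to push the identity through reduction
  modulo a prime of a number field).

Honest framing: bookkeeping for the glue `GeomRigidity → PrimeFieldTransfer` of a conditional
route; `VP ≠ VNP` is NOT proved and nothing here is progress on it.
-/

set_option linter.dupNamespace false

noncomputable section

namespace Summit.ValiantsHypothesis.ValiantsHypothesis.Theorems.GaugeDescent

open MvPolynomial Finset Literature.Computability.AlgebraicComplexity

namespace DescentGlue

variable {σ τ : Type} [Fintype σ] [Fintype τ]

/-! ### Splitting exponents on `σ ⊕ τ` -/

/-- The `σ`-part of an exponent vector on `σ ⊕ τ`. [folklore] -/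
def expL (m : σ ⊕ τ →₀ ℕ) : σ →₀ ℕ :=
  Finsupp.equivFunOnFinite.symm fun a => m (Sum.inl a)

/-- The `τ`-part of an exponent vector on `σ ⊕ τ`. [folklore] -/
def expR (m : σ ⊕ τ →₀ ℕ) : τ →₀ ℕ :=
  Finsupp.equivFunOnFinite.symm fun b => m (Sum.inr b)

omit [Fintype τ] in
/-- `expL m a = m (inl a)`. [folklore] -/
@[simp] theorem expL_apply (m : σ ⊕ τ →₀ ℕ) (a : σ) : expL m a = m (Sum.inl a) := by
  simp [expL]

omit [Fintype σ] in
/-- `expR m b = m (inr b)`. [folklore] -/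
@[simp] theorem expR_apply (m : σ ⊕ τ →₀ ℕ) (b : τ) : expR m b = m (Sum.inr b) := by
  simp [expR]

/-- The degree of an exponent splits as the degrees of its two parts. [folklore] -/
theorem degree_expL_add_degree_expR (m : σ ⊕ τ →₀ ℕ) :
    (expL m).sum (fun _ k => k) + (expR m).sum (fun _ k => k) = m.sum fun _ k => k := by
  rw [Finsupp.sum_fintype _ _ (fun _ => rfl), Finsupp.sum_fintype _ _ (fun _ => rfl),
    Finsupp.sum_fintype _ _ (fun _ => rfl), Fintype.sum_sum_type]
  simp

/-- An exponent on `σ ⊕ τ` is determined by its two parts. [folklore] -/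
theorem exp_ext {m m' : σ ⊕ τ →₀ ℕ} (hL : expL m = expL m') (hR : expR m = expR m') : m = m' := by
  ext i
  rcases i with a | b
  · have := congrArg (fun f => f a) hL
    simpa using this
  · have := congrArg (fun f => f b) hR
    simpa using this

/-! ### The slot polynomials -/

variable [DecidableEq σ]

/-- The SLOT POLYNOMIAL of `Q ∈ ℤ[x_σ, y_τ]` at the `x`-exponent `e`: the coefficient of `x^e` in
`Q`, an integer polynomial in the slot variables `y_τ`. [folklore] -/
def slotPoly (Q : MvPolynomial (σ ⊕ τ) ℤ) (e : σ →₀ ℕ) : MvPolynomial τ ℤ :=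
  ∑ m ∈ Q.support, if expL m = e then monomial (expR m) (Q.coeff m) else 0

/-- The slot polynomials have degree `≤ deg Q`. [folklore] -/
theorem totalDegree_slotPoly_le (Q : MvPolynomial (σ ⊕ τ) ℤ) (e : σ →₀ ℕ) :
    (slotPoly Q e).totalDegree ≤ Q.totalDegree := by
  unfold slotPoly
  refine totalDegree_finsetSum_le fun m hm => ?_
  split_ifs with h
  · refine (totalDegree_monomial_le _ _).trans ?_
    refine le_trans ?_ (le_totalDegree hm)
    rw [← degree_expL_add_degree_expR m]
    exact Nat.le_add_left _ _
  · simp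

/-- The slot polynomials have weight `≤ wt Q`. [folklore] -/
theorem weight_slotPoly_le (Q : MvPolynomial (σ ⊕ τ) ℤ) (e : σ →₀ ℕ) :
    weight (slotPoly Q e) ≤ weight Q := by
  unfold slotPoly
  refine (weight_finset_sum_le _ _).trans ?_
  show _ ≤ ∑ m ∈ Q.support, (Q.coeff m).natAbs
  refine Finset.sum_le_sum fun m _ => ?_
  split_ifs with h
  · rw [weight_monomial]
  · simp [weight]

/-- Off the `σ`-parts of the support of `Q` the slot polynomial vanishes. [folklore] -/
theorem slotPoly_eq_zero {Q : MvPolynomial (σ ⊕ τ) ℤ} {e : σ →₀ ℕ}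
    (he : e ∉ Q.support.image expL) : slotPoly Q e = 0 := by
  unfold slotPoly
  refine Finset.sum_eq_zero fun m hm => ?_
  rw [if_neg]
  intro h
  exact he (Finset.mem_image.2 ⟨m, hm, h⟩)

/-- **The `x^e`-coefficient of `Q(x, y)` is the slot polynomial at `y`.** [folklore] -/
theorem coeff_aeval_sumElim {A : Type*} [CommRing A] (Q : MvPolynomial (σ ⊕ τ) ℤ) (y : τ → A)
    (e : σ →₀ ℕ) :
    coeff e (aeval (Sum.elim X fun b => C (y b)) Q) = aeval y (slotPoly Q e) := by
  classical
  have hterm : ∀ m : σ ⊕ τ →₀ ℕ,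
      (algebraMap ℤ (MvPolynomial σ A) (Q.coeff m)) *
          ∏ i, (Sum.elim X (fun b => C (y b)) i) ^ m i =
        monomial (expL m) (((Q.coeff m : ℤ) : A) * ∏ b, y b ^ m (Sum.inr b)) := by
    intro m
    rw [Fintype.prod_sum_type]
    simp only [Sum.elim_inl, Sum.elim_inr]
    have h1 : (∏ a, (X a : MvPolynomial σ A) ^ m (Sum.inl a)) = monomial (expL m) 1 := by
      rw [monomial_eq, C_1, one_mul, Finsupp.prod_fintype _ _ (fun _ => by simp)]
      simp
    have h2 : (∏ b, (C (y b) : MvPolynomial σ A) ^ m (Sum.inr b)) = C (∏ b, y b ^ m (Sum.inr b)) := by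
      rw [map_prod]
      simp
    rw [h1, h2, eq_intCast, ← map_intCast (C : A →+* MvPolynomial σ A), mul_comm (C _) (_ * _),
      mul_assoc, ← map_mul, mul_comm (monomial _ _) (C _), C_mul_monomial]
    simp [mul_comm]
  rw [MvPolynomial.aeval_def, eval₂_eq', coeff_sum]
  unfold slotPoly
  rw [map_sum]
  refine Finset.sum_congr rfl fun m _ => ?_
  rw [hterm m, coeff_monomial]
  split_ifs with h
  · rw [aeval_monomial, eq_intCast, Finsupp.prod_fintype _ _ (fun _ => by simp)]
    simp
  · simp

/-- **The skeleton identity is the slot system, exponent by exponent.** [folklore] -/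
theorem aeval_sumElim_eq_map_iff {A : Type*} [CommRing A] (Q : MvPolynomial (σ ⊕ τ) ℤ)
    (T : MvPolynomial σ ℤ) (y : τ → A) :
    aeval (Sum.elim X fun b => C (y b)) Q = map (Int.castRingHom A) T ↔
      ∀ e ∈ Q.support.image expL ∪ T.support, aeval y (slotPoly Q e - C (T.coeff e)) = 0 := by
  constructor
  · intro h e _
    have := congrArg (coeff e) h
    rw [coeff_aeval_sumElim, coeff_map] at this
    rw [map_sub, aeval_C, eq_intCast, this, eq_intCast]
    exact sub_self _
  · intro h
    ext e
    rw [coeff_aeval_sumElim, coeff_map]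
    by_cases he : e ∈ Q.support.image expL ∪ T.support
    · have := h e he
      rw [map_sub, aeval_C, eq_intCast, sub_eq_zero] at this
      rw [this, eq_intCast]
    · rw [Finset.mem_union, not_or] at he
      rw [slotPoly_eq_zero he.1, map_zero, MvPolynomial.notMem_support_iff.1 he.2, map_zero]

/-! ### The slot system as a `Fin s`-indexed family -/

/-- The finite set of `x`-exponents carrying an equation. [folklore] -/
def slotIndex (Q : MvPolynomial (σ ⊕ τ) ℤ) (T : MvPolynomial σ ℤ) : Finset (σ →₀ ℕ) :=
  Q.support.image expL ∪ T.support

/-- The SLOT SYSTEM of the identity `Q(x, y) = T(x)`: `Fin s`-indexed integer polynomials in the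
slots. [folklore] -/
def slotSystem (Q : MvPolynomial (σ ⊕ τ) ℤ) (T : MvPolynomial σ ℤ) :
    Fin (slotIndex Q T).card → MvPolynomial τ ℤ :=
  fun i => slotPoly Q ((slotIndex Q T).equivFin.symm i) -
    C (T.coeff ((slotIndex Q T).equivFin.symm i))

/-- **`Q(x, y) = T` iff `y` solves the slot system.** [folklore] -/
theorem aeval_sumElim_eq_map_iff_slotSystem {A : Type*} [CommRing A] (Q : MvPolynomial (σ ⊕ τ) ℤ)
    (T : MvPolynomial σ ℤ) (y : τ → A) :
    aeval (Sum.elim X fun b => C (y b)) Q = map (Int.castRingHom A) T ↔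
      ∀ i, aeval y (slotSystem Q T i) = 0 := by
  rw [aeval_sumElim_eq_map_iff]
  constructor
  · intro h i
    exact h _ (Finset.coe_mem _)
  · intro h e he
    have := h ((slotIndex Q T).equivFin ⟨e, he⟩)
    simpa [slotSystem] using this

/-- The slot equations have degree `≤ deg Q`. [folklore] -/
theorem totalDegree_slotSystem_le (Q : MvPolynomial (σ ⊕ τ) ℤ) (T : MvPolynomial σ ℤ)
    (i : Fin (slotIndex Q T).card) : (slotSystem Q T i).totalDegree ≤ Q.totalDegree := by
  unfold slotSystem
  refine (totalDegree_sub _ _).trans (max_le (totalDegree_slotPoly_le _ _) ?_)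
  rw [totalDegree_C]
  exact Nat.zero_le _

omit [Fintype σ] [DecidableEq σ] in
/-- A single coefficient is bounded by the weight. [folklore] -/
theorem natAbs_coeff_le_weight (T : MvPolynomial σ ℤ) (e : σ →₀ ℕ) :
    (T.coeff e).natAbs ≤ weight T := by
  classical
  by_cases he : e ∈ T.support
  · unfold weight
    exact Finset.single_le_sum (f := fun m => (T.coeff m).natAbs) (fun _ _ => Nat.zero_le _) he
  · rw [MvPolynomial.notMem_support_iff.1 he]
    simp

/-- The slot equations have weight `≤ wt Q + wt T`. [folklore] -/
theorem weight_slotSystem_le (Q : MvPolynomial (σ ⊕ τ) ℤ) (T : MvPolynomial σ ℤ)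
    (i : Fin (slotIndex Q T).card) : weight (slotSystem Q T i) ≤ weight Q + weight T := by
  unfold slotSystem
  rw [sub_eq_add_neg]
  refine (weight_add_le _ _).trans (Nat.add_le_add (weight_slotPoly_le _ _) ?_)
  rw [weight_neg, weight_C]
  exact natAbs_coeff_le_weight _ _

/-! ### Transfer along relation-preserving maps -/

/-- **Transfer of the skeleton identity.** If every integer polynomial relation satisfied by
`y ∈ A^τ` is satisfied by `y' ∈ B^τ` (e.g. `y' = φ ∘ y` for a ring map `φ` defined on a subring
containing the `y_b`), then `Q(x, y) = T` in `A[x]` implies `Q(x, y') = T` in `B[x]`. [folklore] -/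
theorem aeval_sumElim_eq_map_of_relations {A B : Type*} [CommRing A] [CommRing B]
    (Q : MvPolynomial (σ ⊕ τ) ℤ) (T : MvPolynomial σ ℤ) (y : τ → A) (y' : τ → B)
    (hrel : ∀ P : MvPolynomial τ ℤ, aeval y P = 0 → aeval y' P = 0)
    (h : aeval (Sum.elim X fun b => C (y b)) Q = map (Int.castRingHom A) T) :
    aeval (Sum.elim X fun b => C (y' b)) Q = map (Int.castRingHom B) T := by
  rw [aeval_sumElim_eq_map_iff_slotSystem] at h ⊢
  exact fun i => hrel _ (h i)

omit [Fintype σ] [Fintype τ] [DecidableEq σ] in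
/-- Relations are preserved along ring maps: `y' = φ ∘ y`. [folklore] -/
theorem relations_of_ringHom {A B : Type*} [CommRing A] [CommRing B] (φ : A →+* B) (y : τ → A)
    (P : MvPolynomial τ ℤ) (h : aeval y P = 0) : aeval (fun b => φ (y b)) P = 0 := by
  have : aeval (fun b => φ (y b)) P = φ (aeval y P) := by
    rw [show φ (aeval y P) = φ.toIntAlgHom (aeval y P) from rfl, MvPolynomial.comp_aeval_apply]
    rfl
  rw [this, h, map_zero]

omit [Fintype σ] [Fintype τ] [DecidableEq σ] in
/-- Relations are reflected along INJECTIVE ring maps: if `φ ∘ y` satisfies `P = 0` then so does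
`y`. [folklore] -/
theorem relations_of_injective {A B : Type*} [CommRing A] [CommRing B] (φ : A →+* B)
    (hφ : Function.Injective φ) (y : τ → A) (P : MvPolynomial τ ℤ)
    (h : aeval (fun b => φ (y b)) P = 0) : aeval y P = 0 := by
  have : aeval (fun b => φ (y b)) P = φ (aeval y P) := by
    rw [show φ (aeval y P) = φ.toIntAlgHom (aeval y P) from rfl, MvPolynomial.comp_aeval_apply]
    rfl
  rw [this] at h
  exact hφ (by rw [h, map_zero])

end DescentGlue

end Summit.ValiantsHypothesis.ValiantsHypothesis.Theorems.GaugeDescent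

end
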